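import Literature.AlgebraicGeometry.Modules.CechLocalizedSections
import Literature.AlgebraicGeometry.Modules.TensorAssociator
import Literature.Algebra.Homology.CechLocalizationDegreeZero
import Mathlib.RingTheory.Localization.BaseChange
import Mathlib.Algebra.Module.LocalizedModule.IsLocalization
import Mathlib.AlgebraicGeometry.AffineScheme
import HarnessLib

/-!
# Sections of the localized-sections Čech sheaves `P̌ⁿ(𝓤, F)` over affine opens meeting the faces in affines:
# `Γ(V, P̌ⁿ(𝓤, F)) = Π_α Γ(X, V ⊓ U_α) ⊗_{Γ(X, U_α)} Γ(F, U_α)` (Hartshorne II Prop. 5.1–5.2; Stacks 00EK, 01I7)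

Sequel of `Modules/CechLocalizedSections`. For an open `V` of `X` which is AFFINE and meets every face `U_α` of the
family `𝓤` in an AFFINE open (e.g. any affine open of a separated scheme, for a family of affine opens), the unit
`η_V : Π_α Γ(X, V ⊓ U_α) ⊗_{Γ(X, U_α)} Γ(F, U_α) → Γ(V, P̌ⁿ(𝓤, F))` of the sheafification is BIJECTIVE:

* §1 restriction of a piece to an open `W ⊆ V` with `W ⊓ U_α = D(f)` basic in the affine `V ⊓ U_α` is a
  LOCALIZATION at `f` (`isLocalizedModule_restrictPiece`: `Γ(X, D(f)) = Γ(X, V ⊓ U_α)_f`, Mathlib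
  `IsAffineOpen.isLocalization_basicOpen`, and `S⁻¹B ⊗_A N = S⁻¹(B ⊗_A N)`, Mathlib `IsLocalizedModule.rTensor`);
* §2 hence the pieces over the standard opens `D(g_{k₀} ⋯ g_{k_m})` of a finite family `(g_a)` in `Γ(X, V)` form a
  LOCALIZING SYSTEM in the sense of `Algebra/Homology/CechLocalization` (`isSystem_piece`), to which the degree-zero
  Čech exactness `Algebra/Homology/CechLocalizationDegreeZero` (Stacks 00EK) applies;
* §3 **`toObj_app_injective`**, **`toObj_app_surjective`**, **`toObj_app_bijective`** — the unit is bijective on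
  such `V` (a section killed by `η` vanishes locally, Stacks 007X, hence on a standard cover of each `V ⊓ U_α`, hence
  is zero; a section of the sheafification lifts locally, the lifts agree on the double overlaps of a standard cover
  of `V` by the injectivity just proved, and glue by 00EK).

Everything is PROVED; 0 named facts; instances only of the restriction-of-scalars kind on section rings
(`baseAlgebra`, as Mathlib's `algebra_section_section_basicOpen`). Typed for the cell `pub-hodge-ring2` (Stage I (b)
of the `D⁺_qc` comparison) — a research route conditional on HC_CM, not a corollary; nothing in this file refers to it.

## References

* R. Hartshorne, *Algebraic Geometry*, GTM 52 (1977), II Prop. 5.1 (sheaf property of `M~`, `Γ(D(f), M~) = M_f`),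
  Prop. 5.2 (pp. 110–111). [Hartshorne1977]
* The Stacks Project, Tags 00EK (`0 → M → ⊕ M_{f_i} → ⊕ M_{f_i f_j}`), 01I7, 007X (locally injective / surjective
  unit of the sheafification). [StacksProject]
* U. Görtz, T. Wedhorn, *Algebraic Geometry II*, Springer Spektrum (2023), Lemma 22.36 (p. 349). [GortzWedhorn2023]
-/

noncomputable section

-- `TopCat.Presheaf`/`Scheme.Modules` are not reducible (as in Mathlib's `AlgebraicGeometry/Modules/Sheaf.lean`).
set_option backward.isDefEq.respectTransparency false

universe u

open CategoryTheory CategoryTheory.Limits Opposite TopologicalSpace AlgebraicGeometry TensorProduct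

namespace Literature.AlgebraicGeometry.Modules

namespace PCech

open Cech Literature.Algebra.Homology

variable {X : Scheme.{u}} {ι : Type u} (U : ι → X.Opens) (n : ℕ) (F : X.Modules)

/-! ## §1 Restriction of a piece to a basic open is a localization -/

section Localization

variable (V : X.Opens) (α : Fin (n + 1) → ι)

/-- `Γ(X, V ⊓ U_α)` as an ALGEBRA over `Γ(X, U_α)` (restriction), with the module structure of
`Modules/CechLocalizedSections.baseMod`. [cite: Hartshorne1977, II Prop. 5.2 (p. 110)] -/
instance baseAlgebra : Algebra Γ(X, face U α) Γ(X, V ⊓ face U α) :=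
  Algebra.ofModule (fun a b c => smul_mul_assoc a b c) (fun a b c => mul_smul_comm a b c)

/-- The algebra map is restriction. [cite: Hartshorne1977, II Prop. 5.2 (p. 110)] -/
theorem algebraMap_baseAlgebra_apply (a : Γ(X, face U α)) :
    algebraMap Γ(X, face U α) Γ(X, V ⊓ face U α) a =
      Cech.resO (X := X) (inf_le_right : V ⊓ face U α ≤ face U α) a := by
  change a • (1 : Γ(X, V ⊓ face U α)) = _
  rw [baseMod_smul_def, mul_one]

variable {V} {W : X.Opens} (h : W ≤ V)

/-- The `Γ(X, V ⊓ U_α)`-module structure on a piece over a smaller open `W ⊆ V` (restriction of scalars along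
`Γ(X, V ⊓ U_α) → Γ(X, W ⊓ U_α)`). [cite: Hartshorne1977, II Prop. 5.2 (p. 110)] -/
@[reducible]
def pieceModuleOfLE : Module Γ(X, V ⊓ face U α) (Piece U n F W α) :=
  Module.compHom _ (Cech.resO (X := X) (inf_le_inf_right (face U α) h))

/-- The scalar action of `Γ(X, V ⊓ U_α)` on a piece over `W ⊆ V`, on pure tensors.
[cite: Hartshorne1977, II Prop. 5.2 (p. 110)] -/
theorem pieceModuleOfLE_smul_tmul (c : Γ(X, V ⊓ face U α)) (b : Γ(X, W ⊓ face U α)) (m : Γ(F, face U α)) :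
    (letI := pieceModuleOfLE U n F α h; c • tmul (n := n) b m) =
      tmul (Cech.resO (X := X) (inf_le_inf_right (face U α) h) c * b) m :=
  smul_tmul_inf _ b m

/-- Restriction of pieces is semilinear for the `Γ(X, V ⊓ U_α)`-actions. [cite: Hartshorne1977, II Prop. 5.2 (p. 110)] -/
theorem restrictPiece_smul_inf (c : Γ(X, V ⊓ face U α)) (x : Piece U n F V α) :
    restrictPiece U n F h α (c • x) = Cech.resO (X := X) (inf_le_inf_right (face U α) h) c • restrictPiece U n F h α x := by
  induction x using induction_on with
  | zero => simp only [smul_zero, map_zero]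
  | tmul b m => rw [smul_tmul_inf, restrictPiece_tmul, restrictPiece_tmul, map_mul, smul_tmul_inf]
  | add x y hx hy => simp only [smul_add, map_add, hx, hy]

/-- **Restriction of pieces as a `Γ(X, V ⊓ U_α)`-linear map** `Piece V α → Piece W α`.
[cite: Hartshorne1977, II Prop. 5.2 (p. 110)] -/
def restrictPieceₗ :
    letI := pieceModuleOfLE U n F α h
    Piece U n F V α →ₗ[Γ(X, V ⊓ face U α)] Piece U n F W α :=
  letI := pieceModuleOfLE U n F α h
  { toFun := restrictPiece U n F h α
    map_add' := map_add _
    map_smul' := fun c x => by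
      induction x using induction_on with
      | zero => rw [smul_zero, map_zero]; exact (smul_zero c).symm
      | tmul b m =>
        rw [smul_tmul_inf, restrictPiece_tmul, restrictPiece_tmul, map_mul]
        exact (pieceModuleOfLE_smul_tmul U n F α h c _ m).symm
      | add x y hx hy => rw [smul_add, map_add, hx, hy, map_add]; exact (smul_add c _ _).symm }

/-- `restrictPieceₗ` is `restrictPiece`. [cite: Hartshorne1977, II Prop. 5.2 (p. 110)] -/
@[simp]
theorem restrictPieceₗ_apply (x : Piece U n F V α) :
    (letI := pieceModuleOfLE U n F α h; restrictPieceₗ U n F α h x) = restrictPiece U n F h α x := rfl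

variable (V) in
/-- For `f ∈ Γ(X, V)`: `D(f) ⊓ U_α` is the basic open of `f|_{V ⊓ U_α}` (in the affine `V ⊓ U_α`).
[cite: Hartshorne1977, II Prop. 5.2 (p. 110)] -/
theorem basicOpen_inf_face (f : Γ(X, V)) :
    X.basicOpen f ⊓ face U α =
      X.basicOpen (X.presheaf.map (homOfLE (inf_le_left : V ⊓ face U α ≤ V)).op f) := by
  rw [Scheme.basicOpen_res]
  apply le_antisymm
  · exact le_inf (le_inf ((inf_le_left).trans (X.basicOpen_le f)) inf_le_right) inf_le_left
  · exact le_inf inf_le_right (inf_le_left.trans inf_le_right)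

/-- **`Γ(X, W ⊓ U_α)` is the localization of `Γ(X, V ⊓ U_α)` at `f`** when `W ⊓ U_α = D(f)`, `f ∈ Γ(X, V ⊓ U_α)`,
`V ⊓ U_α` affine (Mathlib `IsAffineOpen.isLocalization_basicOpen`, transported along the equality of opens), for the
algebra structure given by restriction. [cite: Hartshorne1977, II Prop. 5.1 (p. 110)] -/
theorem isLocalization_away_of_inf_face_eq (hVα : IsAffineOpen (V ⊓ face U α)) (f : Γ(X, V ⊓ face U α))
    (hW : W ⊓ face U α = X.basicOpen f) :
    letI := (Cech.resO (X := X) (inf_le_inf_right (face U α) h)).toAlgebra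
    IsLocalization.Away f Γ(X, W ⊓ face U α) := by
  letI := (Cech.resO (X := X) (inf_le_inf_right (face U α) h)).toAlgebra
  have hloc := hVα.isLocalization_basicOpen f
  -- the algebra isomorphism `Γ(X, D(f)) ≃ₐ Γ(X, W ⊓ U_α)` along `W ⊓ U_α = D(f)`
  let e : Γ(X, X.basicOpen f) ≃+* Γ(X, W ⊓ face U α) :=
    (X.presheaf.mapIso (eqToIso hW).op).commRingCatIsoToRingEquiv
  refine IsLocalization.isLocalization_of_algEquiv (Submonoid.powers f)
    (AlgEquiv.ofRingEquiv (f := e) fun a => ?_)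
  change (X.presheaf.map (homOfLE (X.basicOpen_le f)).op ≫ X.presheaf.map (eqToHom hW).op) a =
    X.presheaf.map (homOfLE (inf_le_inf_right (face U α) h)).op a
  rw [← X.presheaf.map_comp, ← op_comp]
  rfl

/-- **Restriction of a piece to `W ⊆ V` with `W ⊓ U_α = D(f)` is a localization at `f`**:
`Γ(X, W ⊓ U_α) ⊗ Γ(F, U_α) = (Γ(X, V ⊓ U_α) ⊗ Γ(F, U_α))_f` (`S⁻¹B ⊗_A N = S⁻¹(B ⊗_A N)`).
[cite: Hartshorne1977, II Prop. 5.1–5.2 (p. 110)] [cite: StacksProject, Tag 01I7] -/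
theorem isLocalizedModule_restrictPiece (hVα : IsAffineOpen (V ⊓ face U α)) (f : Γ(X, V ⊓ face U α))
    (hW : W ⊓ face U α = X.basicOpen f) :
    letI := pieceModuleOfLE U n F α h
    IsLocalizedModule (Submonoid.powers f) (restrictPieceₗ U n F α h) := by
  letI algW : Algebra Γ(X, V ⊓ face U α) Γ(X, W ⊓ face U α) :=
    (Cech.resO (X := X) (inf_le_inf_right (face U α) h)).toAlgebra
  haveI : IsScalarTower Γ(X, face U α) Γ(X, V ⊓ face U α) Γ(X, W ⊓ face U α) :=
    IsScalarTower.of_algebraMap_eq fun a => by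
      rw [RingHom.algebraMap_toAlgebra, algebraMap_baseAlgebra_apply, algebraMap_baseAlgebra_apply,
        Cech.resO_resO]
  haveI := isLocalization_away_of_inf_face_eq U n α h hVα f hW
  -- Mathlib: `S⁻¹B ⊗_A N = S⁻¹(B ⊗_A N)` for `g = algebraMap : B → B_f`
  have key := IsLocalizedModule.rTensor (R := Γ(X, face U α)) (A := Γ(X, V ⊓ face U α))
    (M := Γ(X, V ⊓ face U α)) (M' := Γ(X, W ⊓ face U α)) (Submonoid.powers f) (N := Γ(F, face U α))
    (Algebra.linearMap Γ(X, V ⊓ face U α) Γ(X, W ⊓ face U α))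
  letI := pieceModuleOfLE U n F α h
  -- the two `Γ(X, V ⊓ U_α)`-module structures on `Piece W α` and the two maps agree
  have hsmul : ∀ (c : Γ(X, V ⊓ face U α)) (x : Piece U n F W α),
      (letI := pieceModuleOfLE U n F α h; c • x) =
        @HSMul.hSMul _ _ _ (@instHSMul _ _ (TensorProduct.leftModule (R'' := Γ(X, V ⊓ face U α))).toSMul) c x := by
    intro c x
    induction x using induction_on with
    | zero => simp only [smul_zero]
    | tmul b m => rw [pieceModuleOfLE_smul_tmul U n F α h]
    | add x y hx hy => simp only [smul_add, hx, hy]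
  have hmap : ∀ x : Piece U n F V α, restrictPieceₗ U n F α h x =
      AlgebraTensorModule.rTensor Γ(X, face U α) Γ(F, face U α)
        (Algebra.linearMap Γ(X, V ⊓ face U α) Γ(X, W ⊓ face U α)) x := fun x => rfl
  rw [isLocalizedModule_iff] at key ⊢
  obtain ⟨h₁, h₂, h₃⟩ := key
  refine ⟨fun s => ?_, fun y => ?_, fun {x₁ x₂} hx => ?_⟩
  · obtain ⟨⟨u, v, huv, hvu⟩, hu⟩ := h₁ s
    refine ⟨⟨⟨⟨fun x => u x, fun x y => map_add u x y⟩, fun c x => ?_⟩,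
      ⟨⟨fun x => v x, fun x y => map_add v x y⟩, fun c x => ?_⟩, ?_, ?_⟩, ?_⟩
    · change u (c • x) = c • u x
      rw [hsmul, hsmul, map_smul]
    · change v (c • x) = c • v x
      rw [hsmul, hsmul, map_smul]
    · exact LinearMap.ext fun x => LinearMap.congr_fun huv x
    · exact LinearMap.ext fun x => LinearMap.congr_fun hvu x
    · refine LinearMap.ext fun x => ?_
      change u x = (s : Γ(X, V ⊓ face U α)) • x
      rw [hsmul]
      exact LinearMap.congr_fun hu x
  · obtain ⟨⟨x, s⟩, hxs⟩ := h₂ y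
    refine ⟨⟨x, s⟩, ?_⟩
    change (s : Γ(X, V ⊓ face U α)) • y = restrictPieceₗ U n F α h x
    rw [hsmul, hmap]
    exact hxs
  · exact h₃ (by rwa [hmap, hmap] at hx)

/-- Restriction of pieces along an equality of opens is injective. [cite: Hartshorne1977, II Prop. 5.2 (p. 110)] -/
theorem restrictPiece_injective_of_eq {W₁ W₂ : X.Opens} (e : W₁ = W₂) :
    Function.Injective (restrictPiece U n F (le_of_eq e) α) := by
  subst e
  intro x y hxy
  rwa [restrictPiece_self, restrictPiece_self] at hxy

end Localization

/-! ## §2 The pieces over the standard opens of a finite family form a localizing system -/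

section System

variable {V : X.Opens} (α : Fin (n + 1) → ι) {A : Type u} (g : A → Γ(X, V))

/-- The standard open `D(g_{k₀} ⋯ g_{k_m}) ⊆ V` of a tuple of indices. [cite: StacksProject, Tag 00EK] -/
def sysOpen {m : ℕ} (k : Fin (m + 1) → A) : X.Opens := X.basicOpen (∏ j, g (k j))

/-- `D(g_{k₀} ⋯ g_{k_m}) ≤ V`. [cite: StacksProject, Tag 00EK] -/
theorem sysOpen_le {m : ℕ} (k : Fin (m + 1) → A) : sysOpen g k ≤ V := X.basicOpen_le _

/-- The family restricted to `V ⊓ U_α`: `g_a|_{V ⊓ U_α}`. [cite: StacksProject, Tag 00EK] -/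
def resFamily : A → Γ(X, V ⊓ face U α) :=
  fun a => Cech.resO (X := X) (inf_le_left : V ⊓ face U α ≤ V) (g a)

/-- `D(g_k) ⊓ U_α` is the basic open of `gprod (g|) k` in `V ⊓ U_α`. [cite: StacksProject, Tag 00EK] -/
theorem sysOpen_inf_face {m : ℕ} (k : Fin (m + 1) → A) :
    sysOpen g k ⊓ face U α = X.basicOpen (CechLocalization.gprod (resFamily U n α g) k) := by
  rw [sysOpen, basicOpen_inf_face, map_prod]
  rfl

/-- A face tuple indexes a LARGER standard open: `D(g_k) ≤ D(g_{k ∘ δᵢ})`. [cite: StacksProject, Tag 00EK] -/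
theorem sysOpen_le_sysOpen_faceIdx {m : ℕ} (k : Fin (m + 2) → A) (i : Fin (m + 2)) :
    sysOpen g k ≤ sysOpen g (CechLocalization.faceIdx k i) := by
  have hdvd : (∏ j, g (CechLocalization.faceIdx k i j)) ∣ ∏ j, g (k j) := by
    have hf : ∀ j, CechLocalization.faceIdx k i j = k (i.succAbove j) := fun j => by
      simp [CechLocalization.faceIdx, SimplexCategory.δ]
    rw [Fin.prod_univ_succAbove (fun j => g (k j)) i]
    simp_rw [hf]
    exact Dvd.intro_left _ rfl
  obtain ⟨q, hq⟩ := hdvd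
  change X.basicOpen _ ≤ X.basicOpen _
  rw [hq, X.basicOpen_mul]
  exact inf_le_left

/-- The `Γ(X, V ⊓ U_α)`-module structures on the pieces over the standard opens (restriction of scalars), as a
family (to be bound with `letI`). [cite: Hartshorne1977, II Prop. 5.2 (p. 110)] -/
@[reducible]
def sysModule : ∀ (m : ℕ) (k : Fin (m + 1) → A), Module Γ(X, V ⊓ face U α) (Piece U n F (sysOpen g k) α) :=
  fun _ k => pieceModuleOfLE U n F α (sysOpen_le g k)

/-- The structure maps of the localizing system: restriction of pieces `Piece V α → Piece D(g_k) α`.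
[cite: StacksProject, Tag 00EK] -/
def sysι : letI := sysModule U n F α g
    ∀ (m : ℕ) (k : Fin (m + 1) → A), Piece U n F V α →ₗ[Γ(X, V ⊓ face U α)] Piece U n F (sysOpen g k) α :=
  fun _ k => restrictPieceₗ U n F α (sysOpen_le g k)

/-- **The pieces over the standard opens of `(g_a)` form a localizing system** over `Γ(X, V ⊓ U_α)` for the family
`(g_a|_{V ⊓ U_α})`, when `V ⊓ U_α` is affine. [cite: StacksProject, Tag 00EK] [cite: Hartshorne1977, II Prop. 5.1 (p. 110)] -/
theorem isSystem_piece (hVα : IsAffineOpen (V ⊓ face U α)) :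
    letI := sysModule U n F α g
    CechLocalization.IsSystem (resFamily U n α g) 1 (fun _ k => Piece U n F (sysOpen g k) α) (sysι U n F α g) := by
  letI := sysModule U n F α g
  refine ⟨fun m k => ?_⟩
  have h := isLocalizedModule_restrictPiece U n F α (sysOpen_le g k) hVα (CechLocalization.gprod (resFamily U n α g) k)
    (sysOpen_inf_face U n α g k)
  have e : CechLocalization.pw (resFamily U n α g) 1 k =
      Submonoid.powers (CechLocalization.gprod (resFamily U n α g) k) := by
    rw [CechLocalization.pw, one_mul]
  rw [e]
  exact h

end System

/-! ### Consequences for pieces: separation and gluing on a standard cover -/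

section Glue

variable {V : X.Opens} {α : Fin (n + 1) → ι} {A : Type u} {g : A → Γ(X, V)}

/-- Restriction between the pieces over two standard opens `D(g_k) ⊆ D(g_{k'})`, linear for the
`Γ(X, V ⊓ U_α)`-structures. [cite: StacksProject, Tag 00EK] -/
def sysRestrictₗ {m m' : ℕ} (k₁ : Fin (m + 1) → A) (k₂ : Fin (m' + 1) → A) (hk : sysOpen g k₂ ≤ sysOpen g k₁) :
    letI := sysModule U n F α g
    Piece U n F (sysOpen g k₁) α →ₗ[Γ(X, V ⊓ face U α)] Piece U n F (sysOpen g k₂) α :=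
  letI := sysModule U n F α g
  { toFun := restrictPiece U n F hk α
    map_add' := map_add _
    map_smul' := fun c x => by
      change restrictPiece U n F hk α (Cech.resO (X := X) (inf_le_inf_right (face U α) (sysOpen_le g k₁)) c • x) =
        Cech.resO (X := X) (inf_le_inf_right (face U α) (sysOpen_le g k₂)) c • restrictPiece U n F hk α x
      rw [restrictPiece_smul_inf, Cech.resO_resO] }

/-- The face maps of the localizing system of pieces are restrictions. [cite: StacksProject, Tag 00EK] -/
theorem face_piece_apply (hVα : IsAffineOpen (V ⊓ face U α)) {m : ℕ} (k : Fin (m + 2) → A) (i : Fin (m + 2))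
    (y : Piece U n F (sysOpen g (CechLocalization.faceIdx k i)) α) :
    letI := sysModule U n F α g
    CechLocalization.face (isSystem_piece U n F α g hVα) k i y =
      restrictPiece U n F (sysOpen_le_sysOpen_faceIdx g k i) α y := by
  letI := sysModule U n F α g
  have hu := CechLocalization.transfer_unique (isSystem_piece U n F α g hVα) (CechLocalization.faceIdx k i) k
    (CechLocalization.isUnit_face (isSystem_piece U n F α g hVα) k i)
    (sysRestrictₗ U n F (CechLocalization.faceIdx k i) k (sysOpen_le_sysOpen_faceIdx g k i))
    (LinearMap.ext fun x => restrictPiece_restrictPiece U n F α _ _ x)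
  exact (LinearMap.congr_fun hu y).symm

/-- **Separation**: a piece over `V` whose restrictions to the `D(g_a)` vanish is zero, when the `g_a|_{V ⊓ U_α}`
generate the unit ideal and `V ⊓ U_α` is affine. [cite: StacksProject, Tag 00EK] [cite: Hartshorne1977, II Prop. 5.1 (p. 110)] -/
theorem piece_eq_zero_of_forall_restrict [Finite A] (hVα : IsAffineOpen (V ⊓ face U α))
    (hg : Ideal.span (Set.range (resFamily U n α g)) = ⊤) (x : Piece U n F V α)
    (hx : ∀ a, restrictPiece U n F (X.basicOpen_le (g a)) α x = 0) : x = 0 := by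
  letI := sysModule U n F α g
  refine CechLocalization.eq_zero_of_forall_ι_eq_zero hg (isSystem_piece U n F α g hVα) fun k => ?_
  have hle : sysOpen g k ≤ X.basicOpen (g (k 0)) := le_of_eq (by rw [sysOpen, Fin.prod_univ_one])
  change restrictPiece U n F (sysOpen_le g k) α x = 0
  rw [← restrictPiece_restrictPiece U n F α (X.basicOpen_le (g (k 0))) hle, hx, map_zero]

/-- **Gluing**: pieces over the `D(g_a)` which agree on the `D(g_a g_b)` come from one piece over `V`, when the
`g_a|_{V ⊓ U_α}` generate the unit ideal, `A` is finite and `V ⊓ U_α` is affine (Stacks 00EK for the module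
`Γ(X, V ⊓ U_α) ⊗ Γ(F, U_α)`). [cite: StacksProject, Tag 00EK] [cite: Hartshorne1977, II Prop. 5.1 (p. 110)] -/
theorem exists_piece_of_compatible [Finite A] (hVα : IsAffineOpen (V ⊓ face U α))
    (hg : Ideal.span (Set.range (resFamily U n α g)) = ⊤) (c : ∀ a, Piece U n F (X.basicOpen (g a)) α)
    (hc : ∀ a b, restrictPiece U n F (W := X.basicOpen (g a * g b))
        (by rw [Scheme.basicOpen_mul]; exact inf_le_left) α (c a) =
      restrictPiece U n F (W := X.basicOpen (g a * g b)) (by rw [Scheme.basicOpen_mul]; exact inf_le_right) α (c b)) :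
    ∃ x : Piece U n F V α, ∀ a, restrictPiece U n F (X.basicOpen_le (g a)) α x = c a := by
  letI := sysModule U n F α g
  have hL := isSystem_piece U n F α g hVα
  -- the single-index opens
  have e₁ : ∀ k : Fin 1 → A, sysOpen g k = X.basicOpen (g (k 0)) := fun k => by
    rw [sysOpen, Fin.prod_univ_one]
  -- the 0-cochain
  let s : CechLocalization.Cochain (fun _ k => Piece U n F (sysOpen g k) α) 0 :=
    fun k => restrictPiece U n F (le_of_eq (e₁ k)) α (c (k 0))
  -- restriction of `s k₁` to a smaller standard open is the restriction of `c (k₁ 0)`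
  have key : ∀ {m : ℕ} (k' : Fin (m + 1) → A) (k₁ : Fin 1 → A) (hk : sysOpen g k' ≤ sysOpen g k₁),
      restrictPiece U n F hk α (s k₁) = restrictPiece U n F (hk.trans (le_of_eq (e₁ k₁))) α (c (k₁ 0)) :=
    fun k' k₁ hk => restrictPiece_restrictPiece U n F α _ _ _
  have hs : CechLocalization.cechD hL 0 s = 0 := by
    funext k'
    rw [CechLocalization.cechD_apply, Fin.sum_univ_two, face_piece_apply U n F hVα, face_piece_apply U n F hVα,
      key, key]
    have e0 : CechLocalization.faceIdx k' 0 0 = k' 1 := rfl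
    have e1' : CechLocalization.faceIdx k' 1 0 = k' 0 := rfl
    -- `sysOpen g k' = D(g_{a'} g_{b'})` with `a' = (k' ∘ δ₁) 0 = k' 0`, `b' = (k' ∘ δ₀) 0 = k' 1`
    have h2 : sysOpen g k' =
        X.basicOpen (g (CechLocalization.faceIdx k' 1 0) * g (CechLocalization.faceIdx k' 0 0)) := by
      rw [e0, e1', sysOpen, Fin.prod_univ_two]
    -- both terms are the restriction of `c a'|_{D(g_{a'} g_{b'})} = c b'|_{D(g_{a'} g_{b'})}` to `sysOpen g k'`
    have hc' := hc (CechLocalization.faceIdx k' 1 0) (CechLocalization.faceIdx k' 0 0)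
    have t₀ : restrictPiece U n F ((sysOpen_le_sysOpen_faceIdx g k' 0).trans (le_of_eq (e₁ _))) α
        (c (CechLocalization.faceIdx k' 0 0)) =
        restrictPiece U n F (le_of_eq h2) α (restrictPiece U n F (W := X.basicOpen (g _ * g _))
          (by rw [Scheme.basicOpen_mul]; exact inf_le_right) α (c (CechLocalization.faceIdx k' 0 0))) :=
      (restrictPiece_restrictPiece U n F α _ _ _).symm
    have t₁ : restrictPiece U n F ((sysOpen_le_sysOpen_faceIdx g k' 1).trans (le_of_eq (e₁ _))) α
        (c (CechLocalization.faceIdx k' 1 0)) =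
        restrictPiece U n F (le_of_eq h2) α (restrictPiece U n F (W := X.basicOpen (g _ * g _))
          (by rw [Scheme.basicOpen_mul]; exact inf_le_left) α (c (CechLocalization.faceIdx k' 1 0))) :=
      (restrictPiece_restrictPiece U n F α _ _ _).symm
    rw [t₀, t₁, hc']
    simp
  obtain ⟨r, hr⟩ := CechLocalization.exists_eq_ι_of_cechD_eq_zero hg hL s hs
  refine ⟨r, fun a => restrictPiece_injective_of_eq U n F α (e₁ (CechLocalization.single a)) ?_⟩
  exact (restrictPiece_restrictPiece U n F α _ _ r).trans (hr (CechLocalization.single a))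

end Glue

/-! ## §3 The sheafification unit is bijective on affine opens meeting the faces in affines -/

section Unit

variable {V : X.Opens}

/-- Restriction of sections of the presheaf `P̌ⁿ` is transitive. [cite: Hartshorne1977, III Lemma 4.2 (p. 220)] -/
theorem restrict_restrict {W Y : X.Opens} (h : W ≤ V) (h' : Y ≤ W) (x : Sections U n F V) :
    restrict U n F h' (restrict U n F h x) = restrict U n F (h'.trans h) x :=
  funext fun α => restrictPiece_restrictPiece U n F α h h' (x α)

/-- The restriction maps of the presheaf `presheafMod U n F` are `restrict` (`resP` of
`Modules/TensorAssociator`). [cite: Hartshorne1977, III Lemma 4.2 (p. 220)] -/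
theorem resP_presheafMod {W : X.Opens} (h : W ≤ V) (x : Sections U n F V) :
    resP (X := X) (presheafMod U n F) h x = restrict U n F h x := rfl

/-- **A finite standard refinement**: a choice of a basic open `D(g_p) ∋ p` of the affine `V` for every point has a
finite subfamily whose functions generate the unit ideal. [cite: StacksProject, Tag 00EK] [cite: Hartshorne1977, II Prop. 5.1 (p. 110)] -/
theorem exists_finset_span_eq_top (hV : IsAffineOpen V) (gp : V → Γ(X, V))
    (hgp : ∀ p : V, (p : X) ∈ X.basicOpen (gp p)) :
    ∃ T : Finset Γ(X, V), (↑T : Set Γ(X, V)) ⊆ Set.range gp ∧ Ideal.span (T : Set Γ(X, V)) = ⊤ := by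
  have hcov : ⨆ f : Set.range gp, X.basicOpen (f : Γ(X, V)) = V := by
    apply le_antisymm (iSup_le fun f => X.basicOpen_le _)
    intro p hp
    exact Opens.mem_iSup.mpr ⟨⟨gp ⟨p, hp⟩, ⟨⟨p, hp⟩, rfl⟩⟩, hgp ⟨p, hp⟩⟩
  have hspan : Ideal.span (Set.range gp) = ⊤ := hV.iSup_basicOpen_eq_self_iff.mp hcov
  obtain ⟨T, hT, h1⟩ := Submodule.mem_span_finite_of_mem_span ((Ideal.eq_top_iff_one _).mp hspan)
  exact ⟨T, hT, (Ideal.eq_top_iff_one _).mpr h1⟩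

/-- The restricted functions of a generating family generate. [cite: StacksProject, Tag 00EK] -/
theorem span_resFamily_eq_top (α : Fin (n + 1) → ι) {A : Type u} (g : A → Γ(X, V))
    (hg : Ideal.span (Set.range g) = ⊤) : Ideal.span (Set.range (resFamily U n α g)) = ⊤ := by
  have h := congrArg (Ideal.map (Cech.resO (X := X) (inf_le_left : V ⊓ face U α ≤ V))) hg
  rw [Ideal.map_span, Ideal.map_top, ← Set.range_comp] at h
  exact h

/-- Basic opens of `V` meet the faces in affine opens when `V` does. [cite: Hartshorne1977, II Prop. 5.1 (p. 110)] -/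
theorem isAffineOpen_basicOpen_inf_face (α : Fin (n + 1) → ι) (hVα : IsAffineOpen (V ⊓ face U α)) (f : Γ(X, V)) :
    IsAffineOpen (X.basicOpen f ⊓ face U α) := by
  rw [basicOpen_inf_face]
  exact hVα.basicOpen _

variable (hV : IsAffineOpen V) (hVα : ∀ α : Fin (n + 1) → ι, IsAffineOpen (V ⊓ face U α))
include hV hVα

/-- **The unit `η_V : Π_α Γ(X, V ⊓ U_α) ⊗ Γ(F, U_α) → Γ(V, P̌ⁿ(𝓤, F))` is INJECTIVE** for `V` affine meeting the faces
in affines: a section killed by `η` vanishes locally (Stacks 007X), hence on a finite standard cover of `V`, hence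
— componentwise, by the separation half of Stacks 00EK for the module `Γ(X, V ⊓ U_α) ⊗ Γ(F, U_α)` — it is zero.
[cite: StacksProject, Tag 00EK] [cite: StacksProject, Tag 007X] [cite: Hartshorne1977, II Prop. 5.1 (p. 110)] -/
theorem toObj_app_injective : Function.Injective ((toObj U n F).app (op V)) := by
  intro x y hxy
  rw [← sub_eq_zero] at hxy ⊢
  rw [← map_sub] at hxy
  generalize x - y = z at hxy ⊢
  -- local vanishing of `z`
  have hloc := fun (p : X) (hp : p ∈ V) => exists_resP_eq_zero_nhds (X := X) (presheafMod U n F) V z hxy p hp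
  choose W hWV hpW hzW using hloc
  have hbo : ∀ p : V, ∃ f : Γ(X, V), X.basicOpen f ≤ W p p.2 ∧ (p : X) ∈ X.basicOpen f :=
    fun p => hV.exists_basicOpen_le ⟨p, hpW p p.2⟩ p.2
  choose gp hgpW hpgp using hbo
  obtain ⟨T, hT, hspan⟩ := exists_finset_span_eq_top hV gp hpgp
  -- `z|_{D(t)} = 0` for `t ∈ T`
  have hzT : ∀ t : (↑T : Set Γ(X, V)), restrict U n F (X.basicOpen_le (t : Γ(X, V))) z = 0 := by
    rintro ⟨t, ht⟩
    obtain ⟨p, rfl⟩ := hT ht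
    have h0 : restrict U n F (hWV p p.2) z = 0 := hzW p p.2
    rw [← restrict_restrict U n F (hWV p p.2) (hgpW p), h0, map_zero]
  haveI : Finite (↑T : Set Γ(X, V)) := T.finite_toSet.to_subtype
  funext α
  refine piece_eq_zero_of_forall_restrict U n F (g := fun t : (↑T : Set Γ(X, V)) => (t : Γ(X, V))) (hVα α)
    (span_resFamily_eq_top U n α _ (by rwa [Subtype.range_coe_subtype, Set.setOf_mem_eq])) (z α) fun t => ?_
  exact congrFun (hzT t) α

/-- **The unit `η_V` is SURJECTIVE** for `V` affine meeting the faces in affines: a section of `P̌ⁿ(𝓤, F)` over `V`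
lifts locally (Stacks 007X), hence on a finite standard cover `(D(t))_{t ∈ T}` of `V`; the lifts agree on the `D(t t')`
by injectivity there, so glue — componentwise, by the gluing half of Stacks 00EK — to a section over `V`, whose image
agrees with the given section on the cover. [cite: StacksProject, Tag 00EK] [cite: StacksProject, Tag 007X]
[cite: Hartshorne1977, II Prop. 5.1 (p. 110)] -/
theorem toObj_app_surjective : Function.Surjective ((toObj U n F).app (op V)) := by
  intro t
  -- local lifts
  have hloc := fun (p : X) (hp : p ∈ V) =>
    exists_sheafifyUnit_app_eq_nhds (X := X) (presheafMod U n F) V t p hp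
  choose W hWV hpW a ha using hloc
  have hbo : ∀ p : V, ∃ f : Γ(X, V), X.basicOpen f ≤ W p p.2 ∧ (p : X) ∈ X.basicOpen f :=
    fun p => hV.exists_basicOpen_le ⟨p, hpW p p.2⟩ p.2
  choose gp hgpW hpgp using hbo
  obtain ⟨T, hT, hspan⟩ := exists_finset_span_eq_top hV gp hpgp
  haveI : Finite (↑T : Set Γ(X, V)) := T.finite_toSet.to_subtype
  -- for `τ ∈ T` a point `p τ` with `gp (p τ) = τ`, and the lift `b τ` over `D(τ) ⊆ W (p τ)`
  have hTp : ∀ τ : (↑T : Set Γ(X, V)), ∃ p : V, gp p = τ := fun τ => hT τ.2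
  choose pτ hpτ using hTp
  have hDW : ∀ τ : (↑T : Set Γ(X, V)), X.basicOpen (τ : Γ(X, V)) ≤ W (pτ τ) (pτ τ).2 := fun τ => by
    rw [← hpτ τ]; exact hgpW (pτ τ)
  let b : ∀ τ : (↑T : Set Γ(X, V)), Sections U n F (X.basicOpen (τ : Γ(X, V))) :=
    fun τ => restrict U n F (hDW τ) (a (pτ τ) (pτ τ).2)
  -- `η (b τ) = t|_{D(τ)}`
  have hb : ∀ τ : (↑T : Set Γ(X, V)),
      (sheafifyUnit (X := X) (presheafMod U n F)).app (op (X.basicOpen (τ : Γ(X, V)))) (b τ) =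
      resP (X := X) (toCommRingedPresheaf ((modulesSheafify X).obj (presheafMod U n F)))
        (X.basicOpen_le (τ : Γ(X, V))) t := by
    intro τ
    have h1 := app_resP (X := X) (sheafifyUnit (X := X) (presheafMod U n F)) (hDW τ) (a (pτ τ) (pτ τ).2)
    rw [ha, resP_resP] at h1
    exact h1
  -- the lifts agree on the double overlaps (injectivity on `D(τ τ')`)
  have hcompat : ∀ τ τ' : (↑T : Set Γ(X, V)),
      restrict U n F (W := X.basicOpen ((τ : Γ(X, V)) * (τ' : Γ(X, V))))
          (by rw [Scheme.basicOpen_mul]; exact inf_le_left) (b τ) =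
        restrict U n F (W := X.basicOpen ((τ : Γ(X, V)) * (τ' : Γ(X, V))))
          (by rw [Scheme.basicOpen_mul]; exact inf_le_right) (b τ') := by
    intro τ τ'
    have h₁ : X.basicOpen ((τ : Γ(X, V)) * (τ' : Γ(X, V))) ≤ X.basicOpen (τ : Γ(X, V)) := by
      rw [Scheme.basicOpen_mul]; exact inf_le_left
    have h₂ : X.basicOpen ((τ : Γ(X, V)) * (τ' : Γ(X, V))) ≤ X.basicOpen (τ' : Γ(X, V)) := by
      rw [Scheme.basicOpen_mul]; exact inf_le_right
    apply toObj_app_injective U n F (hV.basicOpen _) (fun α => isAffineOpen_basicOpen_inf_face U n α (hVα α) _)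
    have e₁ := app_resP (X := X) (sheafifyUnit (X := X) (presheafMod U n F)) h₁ (b τ)
    have e₂ := app_resP (X := X) (sheafifyUnit (X := X) (presheafMod U n F)) h₂ (b τ')
    rw [resP_presheafMod] at e₁ e₂
    refine (e₁.trans ?_).trans e₂.symm
    rw [hb, hb, resP_resP, resP_resP]
  -- glue componentwise
  have hglue : ∀ α, ∃ x : Piece U n F V α,
      ∀ τ : (↑T : Set Γ(X, V)), restrictPiece U n F (X.basicOpen_le (τ : Γ(X, V))) α x = b τ α := fun α =>
    exists_piece_of_compatible U n F (g := fun τ : (↑T : Set Γ(X, V)) => (τ : Γ(X, V))) (hVα α)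
      (span_resFamily_eq_top U n α _ (by rwa [Subtype.range_coe_subtype, Set.setOf_mem_eq]))
      (fun τ => b τ α) (fun τ τ' => congrFun (hcompat τ τ') α)
  choose x hx using hglue
  refine ⟨fun α => x α, ?_⟩
  -- `η x = t`: both agree on the cover `(D(τ))_{τ ∈ T}` of `V`
  have hcover : V ≤ ⨆ τ : (↑T : Set Γ(X, V)), X.basicOpen (τ : Γ(X, V)) :=
    (hV.iSup_basicOpen_eq_self_iff.mpr hspan).ge
  refine TopCat.Sheaf.eq_of_locally_eq' (Cech.abSheaf (obj U n F)) (fun τ : (↑T : Set Γ(X, V)) => X.basicOpen (τ : Γ(X, V)))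
    V (fun τ => homOfLE (X.basicOpen_le _)) hcover _ _ fun τ => ?_
  have hxτ : restrict U n F (X.basicOpen_le (τ : Γ(X, V))) (fun α => x α) = b τ := funext fun α => hx α τ
  have e := app_resP (X := X) (sheafifyUnit (X := X) (presheafMod U n F)) (X.basicOpen_le (τ : Γ(X, V))) (fun α => x α)
  rw [resP_presheafMod, hxτ] at e
  change resP (X := X) (toCommRingedPresheaf ((modulesSheafify X).obj (presheafMod U n F))) (X.basicOpen_le (τ : Γ(X, V)))
      ((toObj U n F).app (op V) (fun α => x α)) =
    resP (X := X) (toCommRingedPresheaf ((modulesSheafify X).obj (presheafMod U n F))) (X.basicOpen_le (τ : Γ(X, V))) t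
  rw [← hb τ]
  exact e.symm

/-- **The unit `η_V : Π_α Γ(X, V ⊓ U_α) ⊗_{Γ(X, U_α)} Γ(F, U_α) → Γ(V, P̌ⁿ(𝓤, F))` is BIJECTIVE** for every affine
open `V` meeting the faces `U_α` in affine opens. [cite: Hartshorne1977, II Prop. 5.1–5.2 (p. 110)]
[cite: StacksProject, Tag 00EK] [cite: GortzWedhorn2023, Lemma 22.36 (p. 349)] -/
theorem toObj_app_bijective : Function.Bijective ((toObj U n F).app (op V)) :=
  ⟨toObj_app_injective U n F hV hVα, toObj_app_surjective U n F hV hVα⟩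

end Unit

end PCech

end Literature.AlgebraicGeometry.Modules

end
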